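import Literature.NumberTheory.EllipticCurves.KimNakamura2020.RankZeroShaBound
import Literature.AlgebraicGeometry.PlaneCurves.WeierstrassChordTangent
import Mathlib.NumberTheory.Padics.RingHoms
import HarnessLib

/-!
# Kim–Nakamura's "exceptional case" at `p = 3` IS the `3`-division polynomial: off `a₂ ≡ 6 (mod 9)`
# no point of `E₀(ℚ₃) ∖ E₁(ℚ₃)` has order `3` (theorems only; companion of `RankZeroShaBound.lean`)

Topic `NumberTheory/EllipticCurves`, sub-directory `KimNakamura2020`. THEOREMS ONLY — no definition,
no named fact, no `sorry`; net named-fact debt `0`. Written by the ARM P referee-reader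
bsd-cited-r10 (cell `pub/bsd-cited/`, D-audit sheet `sheets/D-AUDIT-r10-S5-KimNakamura2020.md`
§C I5) as the KERNEL form of the one link of Kim–Nakamura's rank-`0` bound at `p = 3` whose printed
proof is delegated to preprints.

## What and why

The named facts `KimNakamura2020.rankZero_padicValNat_sha_le_of_maninConstant` /
`…_imprimitive_of_maninConstant` (Kim–Nakamura, J. Number Theory 210 (2020) = arXiv:1808.07726,
Thm 1.7 + Rem 1.8 (1)/(4)) carry at `p ≤ 7` the binder `NonExceptional W p` = the negation of
KN20 Assumption 2.5 on a model (2.1) with all `aᵢ ∈ pℤ_p`; at `p = 3` the printed congruence is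
`a₂ ≡ 6 (mod 9)`. Its role in print: Thm 2.1 ([KN20] arXiv p. 5, "([pannekoek], [kosters-pannekoek])")
`log_E : E₀(K) ⊗ ℤ_p ≅ 𝒪_K` off the exceptional case, whence Cor 2.4 and the evaluation
`⟨ω*_E, exp*(H¹_s(ℚ_p,T))⟩ = ℤ_p` in the proof of Thm 4.5 (arXiv p. 9). KN20's own proof of Thm 2.1
(§2.4) assumes `p > 7`; for `p ≤ 7` it refers to two arXiv preprints (Pannekoek arXiv:1211.5833,
Kosters–Pannekoek arXiv:1703.07888). For `K = ℚ_p` — the only field the rank-`0` inequality evaluates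
at — Thm 2.1 amounts to "`E₀(ℚ_p)` is torsion-free" (then `log_ω(E₁(ℚ_p)) = pℤ_p` and
`[E₀ : E₁] = #Ẽ_ns(𝔽_p) = p` force `log_ω(E₀(ℚ_p)) = ℤ_p`), and torsion-freeness of `E₀(ℚ_p)` splits as:
`E₁(ℚ_p)` is torsion-free (Silverman *AEC* VII.3.4: torsion points are integral at `p ≥ 3`) + the
exponent-`p` quotient `E₀/E₁ ≅ (𝔽_p, +)` + **no point of `E₀ ∖ E₁` has order `p`**. This file proves
the last clause at `p = 3` in the kernel, and shows that it is EXACTLY the content of Assumption 2.5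
(ii): on a (2.1)-model (`aᵢ = 3bᵢ`) a point `P = (x, y)` with `x ∈ ℤ₃ˣ`, `y ∈ ℤ₃` (i.e. `P ∈ E₀ ∖ E₁`:
integral, not reducing to the cusp `(0,0)` of `ȳ² = x̄³`) has order `3` iff `Ψ₃(x) = 0`
(`Literature.AlgebraicGeometry.PlaneCurves.addOrderOf_eq_three_iff_Ψ₃_eval_eq_zero`, Silverman–Tate
Thm 2.1 (c)), and `Ψ₃(x) = 3x⁴ + b₂x³ + 3b₄x² + 3b₆x + b₈` (Silverman *AEC* Ex. 3.7) satisfies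
`Ψ₃(x) = 3x⁴ + 4a₂x³ + 9·G` with `G ∈ ℤ₃` (`eval_Ψ₃_eq_of_coeff_eq_three_mul`), while the curve
equation gives `x ≡ 1 (mod 3)` (`ȳ² = x̄³`, `x̄ ≠ 0`, and `1` is the only non-zero square of `𝔽₃`),
so `Ψ₃(x) ≡ 3 + 4a₂ (mod 9)`, which vanishes iff `a₂ ≡ 6 (mod 9)`. The mod-`9` bookkeeping is ONE
decidable statement over `ZMod 9` (`zmod_nine_core`), reached through `PadicInt.toZModPow 2`.

## Results

* `eval_Ψ₃_eq_of_coeff_eq_three_mul` — the identity `Ψ₃(x) = 3x⁴ + 4a₂x³ + 9G(b, x)` over any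
  commutative ring when `aᵢ = 3bᵢ`.
* `eval_Ψ₃_ne_zero_of_isUnit_three` — for `V/ℚ₃` with `aᵢ = 3bᵢ` (`bᵢ ∈ ℤ`), `¬ 3 ∣ b₂ − 2`, and an
  affine point `(x, y)` of `V` with `x ∈ ℤ₃ˣ`, `y ∈ ℤ₃`: `Ψ₃(x) ≠ 0`.
* `addOrderOf_ne_three_of_isUnit_three`, `three_nsmul_ne_zero_of_isUnit_three` — such a point does not
  have order `3`, and `3 • P ≠ O`.
* `exists_model_three_nsmul_ne_zero_of_nonExceptional_three` — from the fact file's predicate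
  `NonExceptional W 3` (`W/ℚ`): a `u = 1` translate `C • W` whose base change to `ℚ₃` has the property.
Only the direction the audit needs is proved; that the congruence `a₂ ≡ 6 (mod 9)` does produce
`3`-torsion in `E₀(ℚ₃)` (Kosters–Pannekoek Cor. 2, "⇒") is used by no consumer and is not formalised.

HONEST FRAMING: this does not discharge the XL facts A153/A309 (Kato's Euler system, Rubin's bound);
it replaces, at `K = ℚ₃`, one preprint-sourced sentence of their printed proof by a kernel theorem.
Typed ≠ proved ≠ endorsed; nothing is booked by this file.

## References

* C.-H. Kim, K. Nakamura, J. Number Theory 210 (2020) 249–279 = arXiv:1808.07726: (2.1), Thm 2.1,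
  Prop 2.2, Cor 2.3–2.4, Assumption 2.5 (arXiv p. 5), §2.4 (p. 6, `p > 7`), proof of Thm 4.5 (p. 9).
  [KimNakamura2020]
* J. H. Silverman, *The Arithmetic of Elliptic Curves*, GTM 106 (2nd ed.), Exercise 3.7 (`ψ₃`),
  VII.2.1, VII.3.4. [SilvermanAEC2009]
* J. H. Silverman, J. Tate, *Rational Points on Elliptic Curves* (2nd ed.), §2.1 Thm 2.1 (c).
  [SilvermanTate2015]
* M. Kosters, R. Pannekoek, arXiv:1703.07888, Cor. 2; R. Pannekoek, arXiv:1211.5833. [KostersPannekoek2017]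
-/

noncomputable section

open scoped Classical

open Polynomial

namespace Literature.NumberTheory.EllipticCurves.KimNakamura2020

/-! ## §1 The `3`-division polynomial of a (2.1)-model -/

/-- **`Ψ₃` on a model with `aᵢ = 3bᵢ`**: `Ψ₃(x) = 3x⁴ + 4a₂x³ + 9·G(b, x)` with
`G = b₁²x³ + (2b₄ + 3b₁b₃)x² + (3b₃² + 4b₆)x + (3b₁²b₆ + 4b₂b₆ − 3b₁b₃b₄ + 3b₂b₃² − b₄²)`
(expand `b₂ = a₁² + 4a₂`, `b₄ = 2a₄ + a₁a₃`, `b₆ = a₃² + 4a₆`, `b₈` of Mathlib's `Ψ₃`).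
[cite: SilvermanAEC2009, Exercise 3.7 and III.1 (b₂, b₄, b₆, b₈)] -/
theorem eval_Ψ₃_eq_of_coeff_eq_three_mul {R : Type*} [CommRing R] (V : WeierstrassCurve R)
    (b₁ b₂ b₃ b₄ b₆ x : R) (h₁ : V.a₁ = 3 * b₁) (h₂ : V.a₂ = 3 * b₂) (h₃ : V.a₃ = 3 * b₃)
    (h₄ : V.a₄ = 3 * b₄) (h₆ : V.a₆ = 3 * b₆) :
    V.Ψ₃.eval x = 3 * x ^ 4 + 4 * V.a₂ * x ^ 3 +
      9 * (b₁ ^ 2 * x ^ 3 + (2 * b₄ + 3 * b₁ * b₃) * x ^ 2 + (3 * b₃ ^ 2 + 4 * b₆) * x +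
        (3 * b₁ ^ 2 * b₆ + 4 * b₂ * b₆ - 3 * b₁ * b₃ * b₄ + 3 * b₂ * b₃ ^ 2 - b₄ ^ 2)) := by
  simp only [WeierstrassCurve.Ψ₃, WeierstrassCurve.b₂, WeierstrassCurve.b₄, WeierstrassCurve.b₆,
    WeierstrassCurve.b₈, eval_add, eval_mul, eval_pow, eval_C, eval_X, eval_ofNat, h₁, h₂, h₃, h₄, h₆]
  ring

/-- The mod-`9` content of Assumption 2.5 (ii): for residues `z = x̄`, `w = ȳ`, `a = ā₂ ∈ 3ℤ/9ℤ`
with `ȳ² ≡ x̄³ (mod 3)` and `3 ∤ x`, the vanishing `3z⁴ + 4az³ = 0` in `ℤ/9ℤ` forces `a = 6`,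
i.e. `a₂ ≡ 6 (mod 9)`. One decidable statement (`9³` cases); private plumbing. [folklore] -/
private theorem zmod_nine_core : ∀ z w a : ZMod (3 ^ 2), 3 * a = 0 → 3 * (w ^ 2 - z ^ 3) = 0 →
    3 * z ≠ 0 → 3 * z ^ 4 + 4 * a * z ^ 3 = 0 → a = 6 := by
  decide

/-- A `3`-adic unit stays a non-zero-divisor of `3` modulo `9`: `3·x̄ ≠ 0` in `ℤ/9ℤ`; private plumbing.
[folklore] -/
private theorem three_mul_toZModPow_two_ne_zero {x : ℤ_[3]} (hx : IsUnit x) :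
    3 * PadicInt.toZModPow 2 x ≠ 0 := by
  obtain ⟨u, rfl⟩ := hx
  intro h
  have h1 : PadicInt.toZModPow 2 (u : ℤ_[3]) * PadicInt.toZModPow 2 (↑u⁻¹ : ℤ_[3]) = 1 := by
    rw [← map_mul, Units.mul_inv, map_one]
  have h3 : (3 : ZMod (3 ^ 2)) = 0 := by
    calc (3 : ZMod (3 ^ 2))
        = 3 * (PadicInt.toZModPow 2 (u : ℤ_[3]) * PadicInt.toZModPow 2 (↑u⁻¹ : ℤ_[3])) := by
          rw [h1, mul_one]
      _ = 0 := by rw [← mul_assoc, h, zero_mul]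
  exact absurd h3 (by decide)

/-! ## §2 No order-`3` point of `E₀(ℚ₃) ∖ E₁(ℚ₃)` off the exceptional case -/

section Local

variable (V : WeierstrassCurve ℚ_[3]) {b₁ b₂ b₃ b₄ b₆ : ℤ}

/-- **Kim–Nakamura Assumption 2.5 (ii) read through `Ψ₃`, `p = 3`, `K = ℚ₃`.** Let `V/ℚ₃` have
`aᵢ = 3bᵢ` with `bᵢ ∈ ℤ` (a model (2.1)) and `b₂ ≢ 2 (mod 3)` (i.e. `a₂ ≢ 6 (mod 9)`: NOT the
exceptional case). Then for every point `(x, y)` of `V` with `x ∈ ℤ₃ˣ` and `y ∈ ℤ₃` — the points of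
`E₀(ℚ₃) ∖ E₁(ℚ₃)` of this cuspidal model — `Ψ₃(x) ≠ 0`. Proof: `Ψ₃(x) = 3x⁴ + 4a₂x³ + 9G`, the
equation mod `3` reads `ȳ² = x̄³` with `x̄ ≠ 0`, and `zmod_nine_core`.
[cite: KimNakamura2020, Assumption 2.5 with (2.1) (arXiv p. 5); Thm 2.1 (arXiv p. 5)]
[cite: SilvermanAEC2009, Exercise 3.7] -/
theorem eval_Ψ₃_ne_zero_of_isUnit_three (h₁ : V.a₁ = 3 * b₁) (h₂ : V.a₂ = 3 * b₂)
    (h₃ : V.a₃ = 3 * b₃) (h₄ : V.a₄ = 3 * b₄) (h₆ : V.a₆ = 3 * b₆) (hb₂ : ¬ (3 : ℤ) ∣ b₂ - 2)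
    {x y : ℤ_[3]} (hx : IsUnit x) (hxy : V.toAffine.Equation (x : ℚ_[3]) (y : ℚ_[3])) :
    V.Ψ₃.eval (x : ℚ_[3]) ≠ 0 := by
  -- the integral element `G(b, x)` and the integral form of `Ψ₃(x)`
  set G : ℤ_[3] := (b₁ : ℤ_[3]) ^ 2 * x ^ 3 + (2 * b₄ + 3 * b₁ * b₃) * x ^ 2 +
    (3 * b₃ ^ 2 + 4 * b₆) * x + (3 * b₁ ^ 2 * b₆ + 4 * b₂ * b₆ - 3 * b₁ * b₃ * b₄ + 3 * b₂ * b₃ ^ 2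
      - b₄ ^ 2) with hG
  -- numerals cross the coercion `ℤ₃ → ℚ₃` (no `simp` lemma for `OfNat` literals)
  have c2 : ((2 : ℤ_[3]) : ℚ_[3]) = 2 := by norm_cast
  have c3 : ((3 : ℤ_[3]) : ℚ_[3]) = 3 := by norm_cast
  have c4 : ((4 : ℤ_[3]) : ℚ_[3]) = 4 := by norm_cast
  have c9 : ((9 : ℤ_[3]) : ℚ_[3]) = 9 := by norm_cast
  have hΨ : V.Ψ₃.eval (x : ℚ_[3]) =
      ((3 * x ^ 4 + 4 * (3 * b₂) * x ^ 3 + 9 * G : ℤ_[3]) : ℚ_[3]) := by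
    rw [eval_Ψ₃_eq_of_coeff_eq_three_mul V (b₁ : ℚ_[3]) b₂ b₃ b₄ b₆ x
      (by simpa using h₁) (by simpa using h₂) (by simpa using h₃) (by simpa using h₄)
      (by simpa using h₆), h₂, hG]
    push_cast
    simp only [c2, c3, c4, c9]
  -- the curve equation as an identity in `ℤ₃`
  have hE := (WeierstrassCurve.Affine.equation_iff ..).1 hxy
  rw [h₁, h₂, h₃, h₄, h₆] at hE
  have hEZ : y ^ 2 + 3 * b₁ * x * y + 3 * b₃ * y =
      x ^ 3 + 3 * b₂ * x ^ 2 + 3 * b₄ * x + (3 * b₆ : ℤ_[3]) := by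
    apply PadicInt.ext
    push_cast
    simp only [c3]
    linear_combination hE
  intro h0
  have hT : (3 * x ^ 4 + 4 * (3 * b₂) * x ^ 3 + 9 * G : ℤ_[3]) = 0 := by
    apply PadicInt.ext
    rw [← hΨ, h0]
    rfl
  -- reduce modulo 9
  have nine : (9 : ZMod (3 ^ 2)) = 0 := by decide
  have hz : 3 * PadicInt.toZModPow 2 x ≠ 0 := three_mul_toZModPow_two_ne_zero hx
  have hred := congrArg (PadicInt.toZModPow 2) hT
  have hEq := congrArg (PadicInt.toZModPow 2) hEZ
  simp only [map_add, map_sub, map_mul, map_pow, map_intCast, map_ofNat, map_zero, hG] at hred hEq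
  set z := PadicInt.toZModPow 2 x
  set w := PadicInt.toZModPow 2 y
  have ha : 3 * (3 * (b₂ : ZMod (3 ^ 2))) = 0 := by
    linear_combination (b₂ : ZMod (3 ^ 2)) * nine
  have hw : 3 * (w ^ 2 - z ^ 3) = 0 := by
    linear_combination (3 : ZMod (3 ^ 2)) * hEq +
      ((b₂ : ZMod (3 ^ 2)) * z ^ 2 + (b₄ : ZMod (3 ^ 2)) * z + (b₆ : ZMod (3 ^ 2))
        - (b₁ : ZMod (3 ^ 2)) * z * w - (b₃ : ZMod (3 ^ 2)) * w) * nine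
  have hΨ9 : 3 * z ^ 4 + 4 * (3 * (b₂ : ZMod (3 ^ 2))) * z ^ 3 = 0 := by
    linear_combination hred - ((b₁ : ZMod (3 ^ 2)) ^ 2 * z ^ 3
      + (2 * (b₄ : ZMod (3 ^ 2)) + 3 * b₁ * b₃) * z ^ 2 + (3 * (b₃ : ZMod (3 ^ 2)) ^ 2 + 4 * b₆) * z
      + (3 * (b₁ : ZMod (3 ^ 2)) ^ 2 * b₆ + 4 * b₂ * b₆ - 3 * b₁ * b₃ * b₄ + 3 * b₂ * b₃ ^ 2
        - b₄ ^ 2)) * nine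
  have h6 : 3 * (b₂ : ZMod (3 ^ 2)) = 6 := zmod_nine_core z w _ ha hw hz hΨ9
  -- `3·b̄₂ = 6` in `ℤ/9ℤ` says `3 ∣ b₂ − 2`
  apply hb₂
  have h9 : ((3 * (b₂ - 2) : ℤ) : ZMod (3 ^ 2)) = 0 := by
    push_cast
    linear_combination h6
  rw [ZMod.intCast_zmod_eq_zero_iff_dvd] at h9
  norm_num at h9
  omega

/-- **No point of `E₀(ℚ₃) ∖ E₁(ℚ₃)` has order `3` off the exceptional case** (same hypotheses):
`addOrderOf (x, y) ≠ 3`, by `eval_Ψ₃_ne_zero_of_isUnit_three` and the tree's characteristic-free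
"order `3` ⟺ `Ψ₃(x) = 0`" (`addOrderOf_eq_three_iff_Ψ₃_eval_eq_zero`).
[cite: KimNakamura2020, Assumption 2.5 and Thm 2.1 (arXiv p. 5)]
[cite: SilvermanTate2015, §2.1 Thm. 2.1 (c)] -/
theorem addOrderOf_ne_three_of_isUnit_three (h₁ : V.a₁ = 3 * b₁) (h₂ : V.a₂ = 3 * b₂)
    (h₃ : V.a₃ = 3 * b₃) (h₄ : V.a₄ = 3 * b₄) (h₆ : V.a₆ = 3 * b₆) (hb₂ : ¬ (3 : ℤ) ∣ b₂ - 2)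
    {x y : ℤ_[3]} (hx : IsUnit x) (hxy : V.toAffine.Nonsingular (x : ℚ_[3]) (y : ℚ_[3])) :
    addOrderOf (WeierstrassCurve.Affine.Point.some (x : ℚ_[3]) (y : ℚ_[3]) hxy) ≠ 3 := by
  classical
  rw [Ne, Literature.AlgebraicGeometry.PlaneCurves.addOrderOf_eq_three_iff_Ψ₃_eval_eq_zero V hxy]
  exact eval_Ψ₃_ne_zero_of_isUnit_three V h₁ h₂ h₃ h₄ h₆ hb₂ hx hxy.1

/-- **`3 • P ≠ O`** for every point `P = (x, y)` of `E₀(ℚ₃) ∖ E₁(ℚ₃)` (unit `x`, integral `y`) of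
a non-exceptional (2.1)-model at `p = 3`. [cite: KimNakamura2020, Assumption 2.5 and Thm 2.1 (arXiv p. 5)] -/
theorem three_nsmul_ne_zero_of_isUnit_three (h₁ : V.a₁ = 3 * b₁) (h₂ : V.a₂ = 3 * b₂)
    (h₃ : V.a₃ = 3 * b₃) (h₄ : V.a₄ = 3 * b₄) (h₆ : V.a₆ = 3 * b₆) (hb₂ : ¬ (3 : ℤ) ∣ b₂ - 2)
    {x y : ℤ_[3]} (hx : IsUnit x) (hxy : V.toAffine.Nonsingular (x : ℚ_[3]) (y : ℚ_[3])) :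
    3 • (WeierstrassCurve.Affine.Point.some (x : ℚ_[3]) (y : ℚ_[3]) hxy) ≠ 0 := by
  classical
  intro h3
  set P := WeierstrassCurve.Affine.Point.some (x : ℚ_[3]) (y : ℚ_[3]) hxy with hP
  have hdvd : addOrderOf P ∣ 3 := addOrderOf_dvd_of_nsmul_eq_zero h3
  rcases (Nat.dvd_prime Nat.prime_three).1 hdvd with h1 | h3'
  · rw [AddMonoid.addOrderOf_eq_one_iff, hP] at h1
    exact WeierstrassCurve.Affine.Point.some_ne_zero hxy h1
  · exact addOrderOf_ne_three_of_isUnit_three V h₁ h₂ h₃ h₄ h₆ hb₂ hx hxy h3'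

end Local

/-! ## §3 From the fact file's predicate `NonExceptional W 3` -/

/-- **`NonExceptional W 3` ⟹ a (2.1)-model over `ℚ₃` on which no point of `E₀ ∖ E₁` has order `3`.**
For `W/ℚ`, the predicate of `RankZeroShaBound.lean` supplies a translate `C • W` (`u = 1`, so the
same discriminant) with `aᵢ = 3bᵢ`, `bᵢ ∈ ℤ`, `3 ∤ b₂ − 2`; on its base change to `ℚ₃`, every point
`(x, y)` with `x ∈ ℤ₃ˣ`, `y ∈ ℤ₃` satisfies `3 • (x, y) ≠ O`.
[cite: KimNakamura2020, Assumption 2.5 with (2.1) and Thm 2.1 (arXiv p. 5)]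
[cite: KostersPannekoek2017, Cor. 2 (the direction "not exceptional ⇒ no `p`-torsion", at `K = ℚ₃`)] -/
theorem exists_model_three_nsmul_ne_zero_of_nonExceptional_three (W : WeierstrassCurve ℚ)
    (hNE : NonExceptional W 3) :
    ∃ C : WeierstrassCurve.VariableChange ℚ, C.u = 1 ∧
      ∀ (x y : ℤ_[3]) (hxy : ((C • W).baseChange ℚ_[3]).toAffine.Nonsingular (x : ℚ_[3]) y),
        IsUnit x → 3 • (WeierstrassCurve.Affine.Point.some (x : ℚ_[3]) (y : ℚ_[3]) hxy) ≠ 0 := by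
  obtain ⟨C, hu, b₁, b₂, b₃, b₄, b₆, h₁, h₂, h₃, h₄, h₆, h3⟩ := (nonExceptional_three_iff W).1 hNE
  refine ⟨C, hu, fun x y hxy hx => ?_⟩
  refine three_nsmul_ne_zero_of_isUnit_three ((C • W).baseChange ℚ_[3]) (b₁ := b₁) (b₂ := b₂)
    (b₃ := b₃) (b₄ := b₄) (b₆ := b₆) ?_ ?_ ?_ ?_ ?_ h3 hx hxy
  · simp [WeierstrassCurve.baseChange, h₁]
  · simp [WeierstrassCurve.baseChange, h₂]
  · simp [WeierstrassCurve.baseChange, h₃]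
  · simp [WeierstrassCurve.baseChange, h₄]
  · simp [WeierstrassCurve.baseChange, h₆]

end Literature.NumberTheory.EllipticCurves.KimNakamura2020

end
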